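import Mathlib
import Summits.Ventures.PercRepro2.Defs
import Summits.Ventures.PercRepro2.Independence
import Summits.Ventures.PercRepro2.Harris
import Summits.Ventures.PercRepro2.Graph
import Summits.Ventures.PercRepro2.Exploration
import Summits.Ventures.PercRepro2.Events
import Summits.Ventures.PercRepro2.FourFunctions
import Summits.Ventures.PercRepro2.Induced
import Summits.Ventures.PercRepro2.Frontier
import Summits.Ventures.PercRepro2.ObsIndependence
import Summits.Ventures.PercRepro2.BHK
import Summits.Ventures.PercRepro2.BHKEvents
import Summits.Ventures.PercRepro2.SideAgreement
import Summits.Ventures.PercRepro2.VdBKahn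
import Summits.Ventures.PercRepro2.BHKAvoid
import Summits.Ventures.PercRepro2.R2PrimeThreeReduction
import Summits.Ventures.PercRepro2.YBridge
import Summits.Ventures.PercRepro2.Yu1Functionals
import Summits.Ventures.PercRepro2.Yu1Events
import Summits.Ventures.PercRepro2.Yu1
import Summits.Ventures.PercRepro2.LBSplit
import Summits.Ventures.PercRepro2.YDelta
import Summits.Ventures.PercRepro2.SD
import Summits.Ventures.PercRepro2.Threshold
import Summits.Ventures.PercRepro2.Lambda
import Summits.Ventures.PercRepro2.LambdaTau
import Summits.Ventures.PercRepro2.LambdaSlack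
import Summits.Ventures.PercRepro2.HF2
import Summits.Ventures.PercRepro2.Yu2
import Summits.Ventures.PercRepro2.N0
import Summits.Ventures.PercRepro2.Y
import Summits.Ventures.PercRepro2.YDeltaTools
import Summits.Ventures.PercRepro2.ZDelta
import Summits.Ventures.PercRepro2.ZExpand
import Summits.Ventures.PercRepro2.ISplit
import Summits.Ventures.PercRepro2.MRl
import Summits.Ventures.PercRepro2.ZOloc
import Summits.Ventures.PercRepro2.SideBridge
import Summits.Ventures.PercRepro2.HCov
import Summits.Ventures.PercRepro2.HCovFns
import Summits.Ventures.PercRepro2.HCovSwap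
import Summits.Ventures.PercRepro2.BasePrime
import Summits.Ventures.PercRepro2.PendantRoot
import Summits.Ventures.PercRepro2.PendantO
import Summits.Ventures.PercRepro2.PendantB

/-!
# THEOREM: the pendant-at-`b` row (blind cell PercRepro2, p1 g7; answers ASSIGNMENTS v11.9/v11.10
"pendant-at-`b` sign question"; row 2′PEND case `x = b`, `PendantB.Row`)

With `a₃` a leaf attached to `b` by an edge of weight `q`, mine-a's identity (`Gc_pendant_b`) writes
`Gc` as a quadratic `R(q) = T₀ + q A₁ + q² B₂` in the `a₃`-free masses under `Q = {a₁ ↮ a₂}`: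
`P = P(Q)`, `bL = P(Q, b ∈ C₁)`, `bH`, `oL`, `oH`, `A = P(Q, oL, bL)`, `B = P(Q, oH, bH)`,
`C = P(Q, oH, bL)`, `Dd = P(Q, oL, bH)`; write `D = P − bL − bH = P(Q, b ∉ U)`,
`u = oL − A − Dd = P(Q, oL, b ∉ U)`, `v = oH − B − C = P(Q, oH, b ∉ U)`.

**The Bernstein form of `R` has nonnegative coefficients** (`pendantB_bernstein`, a polynomial identity):

  `R(q) = (1 − q)² · 2P(Z_L + Z_H) + 2q(1 − q) · [(2bL + D) Z_L + (2bH + D) Z_H + P(Y_L + Y_H)]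
          + q² · 2[(2bL + D) Y_L + (2bH + D) Y_H]`

with the four BHK slacks
* `Z_L = oL·bH − P·Dd ≥ 0`, `Z_H = oH·bL − P·C ≥ 0` — BHK06 Thm 1.4 (`bhk_cross_cluster`, the
  landed `PendantRoot.covC_cross_nonpos`);
* `Y_L = bH·u − D·Dd ≥ 0`, `Y_H = bL·v − D·C ≥ 0` — BHK 1.4 with the avoided set `{a₂, b}` resp.
  `{a₁, b}` (`bhk_cross_cluster_avoid`, the landed `CovForm.ToL_mul_D_le` at `a₃ := b`).

Hence (`pendantB_row`) `PendantB.Row` holds for every `q ∈ [0, 1]` and (`HCov_pendant_b`) **(HCOV)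
holds whenever `a₃` is a leaf attached to `b`** — the third attachment-point theorem of the (HCOV)
line (after `HCov_pendant_root`, `HCov_pendant_o`). The `q = 1` case is (HCOV) at the degenerate
marking `a₃ = b`: `R(1) = 2[(2bL + D) Y_L + (2bH + D) Y_H]`. The answer to the sign question is
therefore: the two endpoints and the signs of the BHK pieces DO suffice, once `R` is read in the
Bernstein basis — its middle coefficient `T₀ + A₁/2 = (2bL + D)Z_L + (2bH + D)Z_H + P(Y_L + Y_H)` is
a nonnegative combination of the same four slacks (`A₁ ≤ 0` alone is the weaker identity
`−A₁/2 = bH Z_L + bL Z_H + bH W_L + bL W_H`, `W` the BHK 1.3 slacks).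
Census (own exact code, `mining/p1/g7/pendb*.py`): identity 672/672, `0 ≤ R` on `[0,1]` 12,600 (n = 5)
+ 86,400 (n = 6, m ≤ 9) instances, no interior minimum of a convex `R` ever (0 / 99,000).
-/

namespace Summit.Ventures.PercRepro2

open UnionCluster CovForm PendantRoot

namespace PendantB

variable {V : Type*} {E : Type*} [Fintype E] [DecidableEq E] [Fintype V] [DecidableEq V]
  {R : Type*} [Field R] [LinearOrder R] [IsStrictOrderedRing R]

/-! ## The algebra: Bernstein form with nonnegative coefficients -/

omit [Fintype E] [DecidableEq E] [Fintype V] [DecidableEq V] [LinearOrder R]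
  [IsStrictOrderedRing R] in
/-- **The Bernstein identity** for the cleared pendant-at-`b` quadratic (a polynomial identity in
the nine masses). -/
lemma pendantB_bernstein (P bL bH oL oH A B C Dd q : R) :
    (P * (A + B - C - Dd) - (bL - bH) * (oL - oH)) * (P - q * (bL + bH)) -
        (1 - q) * (P ^ 2 * (A + B + C + Dd) - P * (oL + oH) * (bL + bH)) +
        q * ((oL + oH) - q * (A + B + C + Dd)) * (P * (bL + bH) - (bL - bH) ^ 2) -
        q * (P - q * (bL + bH)) * (P * (A + B + C + Dd) - (bL - bH) * ((A + C) - (Dd + B))) =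
      (1 - q) ^ 2 * (2 * P * ((oL * bH - P * Dd) + (oH * bL - P * C))) +
        2 * q * (1 - q) *
          ((2 * bL + (P - bL - bH)) * (oL * bH - P * Dd) +
            (2 * bH + (P - bL - bH)) * (oH * bL - P * C) +
            P * ((bH * (oL - A - Dd) - (P - bL - bH) * Dd) +
              (bL * (oH - B - C) - (P - bL - bH) * C))) +
        q ^ 2 * (2 * ((2 * bL + (P - bL - bH)) * (bH * (oL - A - Dd) - (P - bL - bH) * Dd) +
          (2 * bH + (P - bL - bH)) * (bL * (oH - B - C) - (P - bL - bH) * C))) := by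
  ring

omit [Fintype E] [DecidableEq E] [Fintype V] [DecidableEq V] in
/-- **Positivity from the four BHK slacks**: for `q ∈ [0, 1]`, nonnegative masses with
`bL + bH ≤ P`, and the slacks `Z_L, Z_H, Y_L, Y_H ≥ 0`, the cleared quadratic is nonnegative. -/
lemma pendantB_expr_nonneg (P bL bH oL oH A B C Dd q : R) (hq0 : 0 ≤ q) (hq1 : q ≤ 1)
    (hP : 0 ≤ P) (hbL : 0 ≤ bL) (hbH : 0 ≤ bH) (hD : 0 ≤ P - bL - bH)
    (hZL : P * Dd ≤ oL * bH) (hZH : P * C ≤ oH * bL)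
    (hYL : (P - bL - bH) * Dd ≤ bH * (oL - A - Dd))
    (hYH : (P - bL - bH) * C ≤ bL * (oH - B - C)) :
    0 ≤ (P * (A + B - C - Dd) - (bL - bH) * (oL - oH)) * (P - q * (bL + bH)) -
        (1 - q) * (P ^ 2 * (A + B + C + Dd) - P * (oL + oH) * (bL + bH)) +
        q * ((oL + oH) - q * (A + B + C + Dd)) * (P * (bL + bH) - (bL - bH) ^ 2) -
        q * (P - q * (bL + bH)) * (P * (A + B + C + Dd) - (bL - bH) * ((A + C) - (Dd + B))) := by
  rw [pendantB_bernstein]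
  have hZL' : 0 ≤ oL * bH - P * Dd := sub_nonneg.2 hZL
  have hZH' : 0 ≤ oH * bL - P * C := sub_nonneg.2 hZH
  have hYL' : 0 ≤ bH * (oL - A - Dd) - (P - bL - bH) * Dd := sub_nonneg.2 hYL
  have hYH' : 0 ≤ bL * (oH - B - C) - (P - bL - bH) * C := sub_nonneg.2 hYH
  have h1q : 0 ≤ 1 - q := sub_nonneg.2 hq1
  have hmL : 0 ≤ 2 * bL + (P - bL - bH) := by linarith
  have hmH : 0 ≤ 2 * bH + (P - bL - bH) := by linarith
  have two_nonneg : (0 : R) ≤ 2 := by norm_num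
  have c0 : 0 ≤ 2 * P * ((oL * bH - P * Dd) + (oH * bL - P * C)) :=
    mul_nonneg (mul_nonneg two_nonneg hP) (add_nonneg hZL' hZH')
  have c1 : 0 ≤ (2 * bL + (P - bL - bH)) * (oL * bH - P * Dd) +
      (2 * bH + (P - bL - bH)) * (oH * bL - P * C) +
      P * ((bH * (oL - A - Dd) - (P - bL - bH) * Dd) +
        (bL * (oH - B - C) - (P - bL - bH) * C)) :=
    add_nonneg (add_nonneg (mul_nonneg hmL hZL') (mul_nonneg hmH hZH'))
      (mul_nonneg hP (add_nonneg hYL' hYH'))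
  have c2 : 0 ≤ 2 * ((2 * bL + (P - bL - bH)) * (bH * (oL - A - Dd) - (P - bL - bH) * Dd) +
      (2 * bH + (P - bL - bH)) * (bL * (oH - B - C) - (P - bL - bH) * C)) :=
    mul_nonneg two_nonneg (add_nonneg (mul_nonneg hmL hYL') (mul_nonneg hmH hYH'))
  have t0 : 0 ≤ (1 - q) ^ 2 := sq_nonneg _
  have t1 : 0 ≤ 2 * q * (1 - q) := mul_nonneg (mul_nonneg two_nonneg hq0) h1q
  have t2 : 0 ≤ q ^ 2 := sq_nonneg _
  exact add_nonneg (add_nonneg (mul_nonneg t0 c0) (mul_nonneg t1 c1)) (mul_nonneg t2 c2)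

/-! ## The four BHK slacks in the vocabulary of `Row` -/

section Slacks

variable (p : E → R) (ends : E → Sym2 V)

omit [Fintype E] [DecidableEq E] [Fintype V] [DecidableEq V] in
/-- `Q ∩ (oL ∩ bH)` as `T(a₃ := b) ∩ oL`. -/
lemma T_inter_oL_eq (o a₁ a₂ b : V) :
    TEvent ends a₁ a₂ b ∩ connEvent ends a₁ o =
      avoidAll ends a₂ {a₁} ∩ (connEvent ends a₁ o ∩ connEvent ends a₂ b) := by
  rw [T_eq_Q_inter, Set.inter_assoc, Set.inter_comm (connEvent ends a₂ b)]

omit [Fintype E] [DecidableEq E] [Fintype V] [DecidableEq V] in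
/-- `Q ∩ (oL ∩ bL)` as `T′(a₃ := b) ∩ oL`. -/
lemma T'_inter_oL_eq (o a₁ a₂ b : V) :
    TEvent ends a₂ a₁ b ∩ connEvent ends a₁ o =
      avoidAll ends a₂ {a₁} ∩ (connEvent ends a₁ o ∩ connEvent ends a₁ b) := by
  rw [T_eq_Q_inter, avoidAll_root_swap, Set.inter_assoc, Set.inter_comm (connEvent ends a₁ b)]

omit [Fintype E] [DecidableEq E] [Fintype V] [DecidableEq V] in
/-- `Q ∩ (oH ∩ bL)` as `T′(a₃ := b) ∩ oH`. -/
lemma T'_inter_oH_eq (o a₁ a₂ b : V) :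
    TEvent ends a₂ a₁ b ∩ connEvent ends a₂ o =
      avoidAll ends a₂ {a₁} ∩ (connEvent ends a₂ o ∩ connEvent ends a₁ b) := by
  rw [T_eq_Q_inter, avoidAll_root_swap, Set.inter_assoc, Set.inter_comm (connEvent ends a₁ b)]

omit [Fintype E] [DecidableEq E] [Fintype V] [DecidableEq V] in
/-- `Q ∩ (oH ∩ bH)` as `T(a₃ := b) ∩ oH`. -/
lemma T_inter_oH_eq (o a₁ a₂ b : V) :
    TEvent ends a₁ a₂ b ∩ connEvent ends a₂ o =
      avoidAll ends a₂ {a₁} ∩ (connEvent ends a₂ o ∩ connEvent ends a₂ b) := by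
  rw [T_eq_Q_inter, Set.inter_assoc, Set.inter_comm (connEvent ends a₂ b)]

omit [Fintype V] [DecidableEq V] [LinearOrder R] [IsStrictOrderedRing R] in
/-- `P(T′(a₃ := b)) = bL`. -/
lemma prob_T'_b (a₁ a₂ b : V) :
    prob p (TEvent ends a₂ a₁ b) = prob p (avoidAll ends a₂ {a₁} ∩ connEvent ends a₁ b) := by
  rw [T_eq_Q_inter, avoidAll_root_swap]

omit [Fintype V] [DecidableEq V] [LinearOrder R] [IsStrictOrderedRing R] in
/-- `P(T(a₃ := b)) = bH`. -/
lemma prob_T_b (a₁ a₂ b : V) :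
    prob p (TEvent ends a₁ a₂ b) = prob p (avoidAll ends a₂ {a₁} ∩ connEvent ends a₂ b) := by
  rw [T_eq_Q_inter]

omit [Fintype V] in
/-- `D = P − bL − bH` at `a₃ := b`. -/
lemma prob_PD_b (a₁ a₂ b : V) :
    prob p (PDEvent ends a₁ a₂ b) =
      prob p (avoidAll ends a₂ {a₁}) - prob p (avoidAll ends a₂ {a₁} ∩ connEvent ends a₁ b) -
        prob p (avoidAll ends a₂ {a₁} ∩ connEvent ends a₂ b) := by
  have h := Qsplit_univ p ends a₁ a₂ b
  rw [prob_T_b, prob_T'_b] at h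
  linarith

omit [Fintype V] in
/-- `P(PD, oL) = oL − A − Dd` at `a₃ := b`. -/
lemma prob_PD_oL_b (o a₁ a₂ b : V) :
    prob p (PDEvent ends a₁ a₂ b ∩ connEvent ends a₁ o) =
      prob p (avoidAll ends a₂ {a₁} ∩ connEvent ends a₁ o) -
        prob p (avoidAll ends a₂ {a₁} ∩ (connEvent ends a₁ o ∩ connEvent ends a₁ b)) -
        prob p (avoidAll ends a₂ {a₁} ∩ (connEvent ends a₁ o ∩ connEvent ends a₂ b)) := by
  have h := Qsplit p ends a₁ a₂ b (connEvent ends a₁ o)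
  rw [T_inter_oL_eq, T'_inter_oL_eq] at h
  linarith

omit [Fintype V] in
/-- `P(PD, oH) = oH − B − C` at `a₃ := b`. -/
lemma prob_PD_oH_b (o a₁ a₂ b : V) :
    prob p (PDEvent ends a₁ a₂ b ∩ connEvent ends a₂ o) =
      prob p (avoidAll ends a₂ {a₁} ∩ connEvent ends a₂ o) -
        prob p (avoidAll ends a₂ {a₁} ∩ (connEvent ends a₂ o ∩ connEvent ends a₂ b)) -
        prob p (avoidAll ends a₂ {a₁} ∩ (connEvent ends a₂ o ∩ connEvent ends a₁ b)) := by
  have h := Qsplit p ends a₁ a₂ b (connEvent ends a₂ o)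
  rw [T_inter_oH_eq, T'_inter_oH_eq] at h
  linarith

/-- **`Y_L ≥ 0`**: `D · Dd ≤ bH · u` — BHK 1.4 with the avoided set `{a₂, b}` (`ToL_mul_D_le` at
`a₃ := b`). -/
lemma YL_nonneg (hp : IsProbVec p) (o a₁ a₂ b : V) :
    (prob p (avoidAll ends a₂ {a₁}) - prob p (avoidAll ends a₂ {a₁} ∩ connEvent ends a₁ b) -
        prob p (avoidAll ends a₂ {a₁} ∩ connEvent ends a₂ b)) *
        prob p (avoidAll ends a₂ {a₁} ∩ (connEvent ends a₁ o ∩ connEvent ends a₂ b)) ≤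
      prob p (avoidAll ends a₂ {a₁} ∩ connEvent ends a₂ b) *
        (prob p (avoidAll ends a₂ {a₁} ∩ connEvent ends a₁ o) -
          prob p (avoidAll ends a₂ {a₁} ∩ (connEvent ends a₁ o ∩ connEvent ends a₁ b)) -
          prob p (avoidAll ends a₂ {a₁} ∩ (connEvent ends a₁ o ∩ connEvent ends a₂ b))) := by
  have h := ToL_mul_D_le p hp ends o a₁ a₂ b
  rw [T_inter_oL_eq, prob_PD_b, prob_PD_oL_b, prob_T_b] at h
  linarith

/-- **`Y_H ≥ 0`**: `D · C ≤ bL · v` — BHK 1.4 with the avoided set `{a₁, b}` (`ToL_mul_D_le` with the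
roots swapped, at `a₃ := b`). -/
lemma YH_nonneg (hp : IsProbVec p) (o a₁ a₂ b : V) :
    (prob p (avoidAll ends a₂ {a₁}) - prob p (avoidAll ends a₂ {a₁} ∩ connEvent ends a₁ b) -
        prob p (avoidAll ends a₂ {a₁} ∩ connEvent ends a₂ b)) *
        prob p (avoidAll ends a₂ {a₁} ∩ (connEvent ends a₂ o ∩ connEvent ends a₁ b)) ≤
      prob p (avoidAll ends a₂ {a₁} ∩ connEvent ends a₁ b) *
        (prob p (avoidAll ends a₂ {a₁} ∩ connEvent ends a₂ o) -
          prob p (avoidAll ends a₂ {a₁} ∩ (connEvent ends a₂ o ∩ connEvent ends a₂ b)) -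
          prob p (avoidAll ends a₂ {a₁} ∩ (connEvent ends a₂ o ∩ connEvent ends a₁ b))) := by
  have h := ToL_mul_D_le p hp ends o a₂ a₁ b
  rw [T'_inter_oH_eq, PDEvent_root_swap, prob_PD_b, prob_PD_oH_b, prob_T'_b] at h
  linarith

/-- **`Z_L ≥ 0`**: `P · Dd ≤ oL · bH` (BHK06 Thm 1.4, `covC_cross_nonpos`). -/
lemma ZL_nonneg (hp : IsProbVec p) (o a₁ a₂ b : V) :
    prob p (avoidAll ends a₂ {a₁}) *
        prob p (avoidAll ends a₂ {a₁} ∩ (connEvent ends a₁ o ∩ connEvent ends a₂ b)) ≤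
      prob p (avoidAll ends a₂ {a₁} ∩ connEvent ends a₁ o) *
        prob p (avoidAll ends a₂ {a₁} ∩ connEvent ends a₂ b) := by
  have h := (covC_cross_nonpos p ends hp o a₁ a₂ b).2
  unfold covC at h
  linarith

/-- **`Z_H ≥ 0`**: `P · C ≤ oH · bL` (BHK06 Thm 1.4, `covC_cross_nonpos`). -/
lemma ZH_nonneg (hp : IsProbVec p) (o a₁ a₂ b : V) :
    prob p (avoidAll ends a₂ {a₁}) *
        prob p (avoidAll ends a₂ {a₁} ∩ (connEvent ends a₂ o ∩ connEvent ends a₁ b)) ≤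
      prob p (avoidAll ends a₂ {a₁} ∩ connEvent ends a₂ o) *
        prob p (avoidAll ends a₂ {a₁} ∩ connEvent ends a₁ b) := by
  have h := (covC_cross_nonpos p ends hp o a₁ a₂ b).1
  unfold covC at h
  linarith

omit [Fintype V] in
/-- `bL + bH ≤ P` (the two clusters of the roots are disjoint under `Q`). -/
lemma bL_add_bH_le (hp : IsProbVec p) (a₁ a₂ b : V) :
    prob p (avoidAll ends a₂ {a₁} ∩ connEvent ends a₁ b) +
        prob p (avoidAll ends a₂ {a₁} ∩ connEvent ends a₂ b) ≤
      prob p (avoidAll ends a₂ {a₁}) := by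
  have h := prob_PD_b p ends a₁ a₂ b
  have hD := prob_nonneg hp (PDEvent ends a₁ a₂ b)
  linarith

end Slacks

/-! ## The theorem -/

section Main

variable (p : E → R) (ends : E → Sym2 V)

/-- **THEOREM: the pendant-at-`b` row holds for every `q ∈ [0, 1]`** (the open 4-marker
statement of row 2′PEND / ASSIGNMENTS v11.9 — settled: it is a nonnegative Bernstein combination of
four BHK 1.4 slacks). -/
theorem pendantB_row (hp : IsProbVec p) (a₁ a₂ o b : V) {q : R} (hq0 : 0 ≤ q) (hq1 : q ≤ 1) :
    Row p ends a₁ a₂ o b q := by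
  unfold Row
  intro Q P bL bH oL oH A B C Dd Sb So mbU moU Sig Ebo EQbo CovC
  have hP : 0 ≤ P := prob_nonneg hp _
  have hbL : 0 ≤ bL := prob_nonneg hp _
  have hbH : 0 ≤ bH := prob_nonneg hp _
  have hD : 0 ≤ P - bL - bH := by
    have := bL_add_bH_le p ends hp a₁ a₂ b
    simp only [P, bL, bH, Q]
    linarith
  exact pendantB_expr_nonneg P bL bH oL oH A B C Dd q hq0 hq1 hP hbL hbH hD
    (ZL_nonneg p ends hp o a₁ a₂ b) (ZH_nonneg p ends hp o a₁ a₂ b)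
    (YL_nonneg p ends hp o a₁ a₂ b) (YH_nonneg p ends hp o a₁ a₂ b)

/-- **(HCOV) at a pendant `a₃` attached to `b`** — the third attachment-point theorem of the (HCOV)
line: `0 ≤ Gc` for every admissible weight vector. -/
theorem HCov_pendant_b (hp : IsProbVec p) {f : E} {a₃ b : V} (hf : ends f = s(a₃, b))
    (hleaf : ∀ e, a₃ ∈ ends e → e = f) (h3b : a₃ ≠ b) {o a₁ a₂ : V} (h31 : a₃ ≠ a₁)
    (h32 : a₃ ≠ a₂) (ho : o ≠ a₃) : HCov p ends o a₁ a₂ a₃ b := by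
  rw [HCov_pendant_b_iff p ends hf hleaf h3b h31 h32 ho]
  exact pendantB_row p ends hp a₁ a₂ o b (hp.nonneg f) (hp.le_one f)

/-- The `q = 1` case: **(HCOV) at the degenerate marking `a₃ = b`** (`R(1) ≥ 0`). -/
theorem pendantB_row_one (hp : IsProbVec p) (a₁ a₂ o b : V) : Row p ends a₁ a₂ o b 1 :=
  pendantB_row p ends hp a₁ a₂ o b zero_le_one le_rfl

end Main

end PendantB

end Summit.Ventures.PercRepro2
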